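import Summits.AtomisticToContinuum.BoseEinsteinCondensation.Theorems.BECCutLineWeakDisorderWitnessTransferLevelSet
import Summits.AtomisticToContinuum.BoseEinsteinCondensation.Theorems.BECCutLineWeakDisorderWitnessTransferHardSetMargin
import Summits.AtomisticToContinuum.BoseEinsteinCondensation.Theorems.BECCutLineWeakDisorderWitnessTransferConvergence
import Literature.MathematicalPhysics.QuantumManyBody.GroundStateFeynmanKacTrialState
import HarnessLib

/-!
# Route BECCutLineWeakDisorder — `WitnessTransfer`, line `Sketch`: the landscape witness at finite `T`

Support file (does not close the item) for the crux stmt-AtomisticToContinuum-14978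
(`Summit.AtomisticToContinuum.BoseEinsteinCondensation.Theses.BECCutLineWeakDisorder.WitnessTransfer`):
`glue_landscape_at`, the per-`(n, L, δ)` core of the glue `stub_landscape_of_parts` of the
registered skeleton (`Cruxes/WitnessTransfer/Lines/Sketch.lean`). The analytic parts (B), (C), (E1a),
(E1b), (F), (E2) enter as hypotheses in their registered signatures; this file is the construction
and the bookkeeping (choice of `T`, truncation level `η`, margins, mollification radius).
-/

noncomputable section

open MeasureTheory Filter Set Metric
open scoped ENNReal NNReal Topology

namespace Summit.AtomisticToContinuum.BoseEinsteinCondensation.Theorems.CutLineWitness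

open Literature.MathematicalPhysics.QuantumManyBody.BoseGas
/-! ### The landscape witness at finite `T` -/

/-- **The finite-`T` landscape witness at fixed `(n, L, δ)`.** Given the parts (B) eigen-inequality
of the witness, (C) lower envelope of the partition norm, (E1a) form bound, (E1b) trial states by
mollification, (F) ratio under mollification (as hypotheses, in the registered signatures), an
admissible `v` with (E2) the vanishing of `e^{-TH}1` near ITS hard set, `L > 0`, finite `E₀ = groundStateEnergy v (n+1) L`,
and the two-replica bound `R_L(Ψ_T) ≤ C` for all `T ≥ 1` on the witnesses `Ψ_T = fkWitness v L T 1`: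
for every `δ > 0` there is a nonnegative trial state with energy `≤ E₀ + δ` and ratio `≤ C + 1`.
Construction: `T = max 1 (2ℓ/δ + 1)` so that the slope energy `E_T ≤ E₀ + δ/4`; truncate `Ψ_T` at a
level `η` (norm and ratio move little); the support then keeps margins from the walls
(`glue_wall_vanish`) and from the hard set ((E2)), where the interaction is integrable
(`glue_setLIntegral_interaction_ne_top`); mollify ((E1b)) at a radius given by (F). [folklore] -/
theorem glue_landscape_at
    (HB : ∀ {N : ℕ} {v : ℝ → ℝ≥0∞} (_ : Measurable v) (L : ℝ) {T : ℝ} (_ : 0 < T)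
      (_ : fkNormSq (N := N) v L T (fun _ => 1) ≠ 0) {t : ℝ} (_ : 0 < t),
      Real.exp (-(Real.log ((fkNormSq (N := N) v L 0 (fun _ => 1)).toReal /
          (fkNormSq (N := N) v L T (fun _ => 1)).toReal) / (2 * T) * t)) ≤
        ∫ X, fkWitness (N := N) v L T (fun _ => (1 : ℝ≥0∞)) X *
          fkReal v L t (fkWitness (N := N) v L T (fun _ => (1 : ℝ≥0∞))) X)
    (HC : ∀ {N : ℕ} {v : ℝ → ℝ≥0∞} (_ : Measurable v) {L : ℝ} (_ : 0 < L) (_ : 1 ≤ N)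
      (_ : groundStateEnergy v N L ≠ ⊤),
      ∃ c : ℝ, 0 < c ∧ ∀ T : ℝ, 0 ≤ T →
        ENNReal.ofReal (c * Real.exp (-(2 * (groundStateEnergy v N L).toReal * T))) ≤
          fkNormSq (N := N) v L T (fun _ => 1))
    (HE1a : ∀ {N : ℕ} {v : ℝ → ℝ≥0∞} (_ : Measurable v) {L : ℝ} (_ : 0 < L)
      {Ψ : Config N → ℝ} (_ : Measurable Ψ) {M : ℝ} (_ : ∀ X, |Ψ X| ≤ M) (_ : ∀ X, 0 ≤ Ψ X)
      (_ : ∀ X, X ∉ boxN N L → Ψ X = 0) (_ : ∫ X, Ψ X ^ 2 = 1) {E : ℝ}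
      (_ : ∀ t : ℝ, 0 < t → Real.exp (-(E * t)) ≤ ∫ X, Ψ X * fkReal v L t Ψ X),
      (∫⁻ X, ENNReal.ofReal (Ψ X ^ 2) * interaction v X) ≤ ENNReal.ofReal E ∧
      ∀ ε : ℝ, 0 < ε → ∀ᶠ t : ℝ≥0 in 𝓝[>] 0, (ENNReal.ofReal (2 * t))⁻¹ * sqIncr t Ψ ≤
        ENNReal.ofReal (E - (∫⁻ X, ENNReal.ofReal (Ψ X ^ 2) * interaction v X).toReal + ε))
    (HE1b : ∀ {N : ℕ} {v : ℝ → ℝ≥0∞} (_ : Measurable v) {L : ℝ} (_ : 0 < L)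
      {f : Config N → ℝ} (_ : Measurable f) {M : ℝ} (_ : ∀ X, |f X| ≤ M) (_ : ∀ X, 0 ≤ f X)
      (_ : ∀ (σ : Equiv.Perm (Fin N)) (X : Config N), f (X ∘ σ) = f X)
      (_ : 0 < ∫ X, f X ^ 2)
      {S : Set (Config N)} (_ : MeasurableSet S) (_ : S ⊆ boxN N L) {r₀ : ℝ} (_ : 0 < r₀)
      (_ : ∀ X, f X ≠ 0 → Metric.closedBall X r₀ ⊆ S)
      (_ : ∫⁻ X in S, interaction v X ≠ ⊤)
      {K : ℝ} (_ : 0 ≤ K)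
      (_ : ∀ ε : ℝ, 0 < ε → ∀ᶠ t : ℝ≥0 in 𝓝[>] 0,
        (ENNReal.ofReal (2 * t))⁻¹ * sqIncr t f ≤ ENNReal.ofReal (K + ε))
      {ε : ℝ} (_ : 0 < ε),
      ∃ r₁ : ℝ, 0 < r₁ ∧ ∀ (r : ℝ) (hr : 0 < r), r < r₁ → ∃ (c : ℝ) (Φ : TrialState N L),
        0 < c ∧ c ^ 2 * ∫ X, f X ^ 2 ≤ 1 + ε ∧
        (Φ.ψ = fun X => (((c * mollify hr f X : ℝ)) : ℂ)) ∧
        energy v Φ ≤ ENNReal.ofReal (c ^ 2) *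
          (ENNReal.ofReal K + (∫⁻ X, ENNReal.ofReal (f X ^ 2) * interaction v X) +
            ENNReal.ofReal ε))
    (HF : ∀ {n : ℕ} {L : ℝ} {f : Config (n + 1) → ℝ} (_ : Measurable f) {M : ℝ}
      (_ : ∀ X, |f X| ≤ M) (_ : ∀ X, 0 ≤ f X) {r₀ : ℝ} (_ : 0 < r₀)
      (_ : ∀ X, f X ≠ 0 → Metric.closedBall X r₀ ⊆ boxN (n + 1) L)
      {ε : ℝ≥0∞} (_ : 0 < ε),
      ∃ᶠ r in 𝓝[>] (0 : ℝ), ∀ hr : 0 < r,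
        ∫⁻ Y : Config n, ENNReal.ofReal (L ^ 3) *
            (∫⁻ x, (‖mollify hr f (Matrix.vecCons x Y)‖₊ : ℝ≥0∞) ^ 2) ^ 2 /
              (∫⁻ x, (‖mollify hr f (Matrix.vecCons x Y)‖₊ : ℝ≥0∞)) ^ 2 ≤
          (∫⁻ Y : Config n, ENNReal.ofReal (L ^ 3) *
            (∫⁻ x, (‖f (Matrix.vecCons x Y)‖₊ : ℝ≥0∞) ^ 2) ^ 2 /
              (∫⁻ x, (‖f (Matrix.vecCons x Y)‖₊ : ℝ≥0∞)) ^ 2) + ε)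
    {v : ℝ → ℝ≥0∞} (hv : IsRepulsiveFiniteRange v)
    (HE2 : ∀ {N : ℕ} (L : ℝ) {T : ℝ} (_ : 0 < T) {η : ℝ} (_ : 0 < η),
      ∃ κ : ℝ, 0 < κ ∧ ∀ X : Config N,
        (∃ i j : Fin N, i ≠ j ∧ ∃ z ∈ hardVec v, dist (X i - X j) z < κ) →
          fkSemigroup v L T (fun _ => (1 : ℝ≥0∞)) X ≤ ENNReal.ofReal η)
    {n : ℕ} {L : ℝ} (hL : 0 < L)
    (hEfin : groundStateEnergy v (n + 1) L ≠ ⊤) {C : ℝ} (hC0 : 0 ≤ C)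
    (hrat : ∀ T : ℝ, 1 ≤ T →
      ∫⁻ Y : Config n, ENNReal.ofReal (L ^ 3) *
        (∫⁻ x, (‖fkWitness (N := n + 1) v L T (fun _ => (1 : ℝ≥0∞)) (Matrix.vecCons x Y)‖₊ :
          ℝ≥0∞) ^ 2) ^ 2 /
        (∫⁻ x, (‖fkWitness (N := n + 1) v L T (fun _ => (1 : ℝ≥0∞)) (Matrix.vecCons x Y)‖₊ :
          ℝ≥0∞)) ^ 2 ≤ ENNReal.ofReal C)
    {δ : ℝ≥0∞} (hδ : 0 < δ) :
    ∃ Ψ : TrialState (n + 1) L,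
      energy v Ψ ≤ groundStateEnergy v (n + 1) L + δ ∧ (∀ X, Ψ.ψ X = (‖Ψ.ψ X‖ : ℂ)) ∧
      ∫⁻ Y : Config n, ENNReal.ofReal (L ^ 3) *
        (∫⁻ x, (‖Ψ.ψ (Matrix.vecCons x Y)‖₊ : ℝ≥0∞) ^ 2) ^ 2 /
          (∫⁻ x, (‖Ψ.ψ (Matrix.vecCons x Y)‖₊ : ℝ≥0∞)) ^ 2 ≤ ENNReal.ofReal (C + 1) := by
  have hvm : Measurable v := hv.1
  set Z : ℝ → ℝ≥0∞ := fun T => fkNormSq (N := n + 1) v L T (fun _ => 1) with hZdef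
  obtain ⟨c, hc, hZ⟩ := HC hvm hL (Nat.le_add_left 1 n) hEfin
  have hZne : ∀ T : ℝ, 0 ≤ T → Z T ≠ 0 := fun T hT h0 => by
    have h1 := hZ T hT
    rw [show fkNormSq (N := n + 1) v L T (fun _ => 1) = Z T from rfl, h0, nonpos_iff_eq_zero,
      ENNReal.ofReal_eq_zero] at h1
    exact absurd h1 (not_le.2 (mul_pos hc (Real.exp_pos _)))
  have hZtop : ∀ T : ℝ, 0 ≤ T → Z T ≠ ⊤ := fun T hT =>
    ne_top_of_le_ne_top (volume_boxN_lt_top (n + 1) L).ne (fkNormSq_one_le v hT)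
  have hZle0 : ∀ T : ℝ, 0 ≤ T → Z T ≤ Z 0 := fun T hT => by
    calc Z T ≤ volume (boxN (n + 1) L) := fkNormSq_one_le v hT
      _ = Z 0 := by
          show volume (boxN (n + 1) L) = fkNormSq (N := n + 1) v L 0 (fun _ => 1)
          rw [fkNormSq_zero]; simp
  set δ' : ℝ≥0∞ := min δ 1 with hδ'def
  have hδ'0 : δ' ≠ 0 := (lt_min hδ one_pos).ne'
  have hδ'top : δ' ≠ ⊤ := ne_top_of_le_ne_top ENNReal.one_ne_top (min_le_right _ _)
  set δr : ℝ := δ'.toReal with hδrdef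
  have hδr : 0 < δr := ENNReal.toReal_pos hδ'0 hδ'top
  have hδrδ : ENNReal.ofReal δr ≤ δ := by rw [hδrdef, ENNReal.ofReal_toReal hδ'top]; exact min_le_left _ _
  set E₀ : ℝ≥0∞ := groundStateEnergy v (n + 1) L with hE₀def
  set E₀r : ℝ := E₀.toReal with hE₀rdef
  have hE₀r : 0 ≤ E₀r := ENNReal.toReal_nonneg
  have hE₀eq : E₀ = ENNReal.ofReal E₀r := (ENNReal.ofReal_toReal hEfin).symm
  set Z0r : ℝ := (Z 0).toReal with hZ0rdef
  have hZ0r : 0 < Z0r := ENNReal.toReal_pos (hZne 0 le_rfl) (hZtop 0 le_rfl)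
  set ℓ : ℝ := max (Real.log (Z0r / c)) 0 with hℓdef
  have hℓ0 : 0 ≤ ℓ := le_max_right _ _
  set T : ℝ := max 1 (2 * ℓ / δr + 1) with hTdef
  have hT1 : 1 ≤ T := le_max_left _ _
  have hT0 : 0 < T := one_pos.trans_le hT1
  have hTℓ : 2 * ℓ ≤ T * δr := by
    have h1 : 2 * ℓ / δr + 1 ≤ T := le_max_right _ _
    have h2 : 2 * ℓ / δr ≤ T := by linarith
    rwa [div_le_iff₀ hδr] at h2
  set ZTr : ℝ := (Z T).toReal with hZTrdef
  have hZTr : 0 < ZTr := ENNReal.toReal_pos (hZne T hT0.le) (hZtop T hT0.le)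
  have hZTr_le : ZTr ≤ Z0r := ENNReal.toReal_mono (hZtop 0 le_rfl) (hZle0 T hT0.le)
  have hcZ : c * Real.exp (-(2 * E₀r * T)) ≤ ZTr := by
    have h1 := hZ T hT0.le
    have h2 := ENNReal.toReal_mono (hZtop T hT0.le) h1
    rwa [ENNReal.toReal_ofReal (mul_pos hc (Real.exp_pos _)).le] at h2
  set E : ℝ := Real.log (Z0r / ZTr) / (2 * T) with hEdef
  have hE0 : 0 ≤ E := by
    rw [hEdef]
    exact div_nonneg (Real.log_nonneg ((one_le_div hZTr).2 hZTr_le)) (by positivity)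
  have hE_le : E ≤ E₀r + δr / 4 := by
    have h1 : Real.log (Z0r / ZTr) ≤ ℓ + 2 * E₀r * T := by
      have h2 : Z0r / ZTr ≤ Z0r / (c * Real.exp (-(2 * E₀r * T))) :=
        div_le_div_of_nonneg_left hZ0r.le (mul_pos hc (Real.exp_pos _)) hcZ
      calc Real.log (Z0r / ZTr) ≤ Real.log (Z0r / (c * Real.exp (-(2 * E₀r * T)))) :=
            Real.log_le_log (div_pos hZ0r hZTr) h2
        _ = Real.log (Z0r / c) + 2 * E₀r * T := by
            rw [div_mul_eq_div_div, Real.log_div (div_pos hZ0r hc).ne' (Real.exp_pos _).ne',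
              Real.log_exp]
            ring
        _ ≤ ℓ + 2 * E₀r * T := by gcongr; exact le_max_left _ _
    rw [hEdef, div_le_iff₀ (by positivity)]
    nlinarith
  have heig : ∀ t : ℝ, 0 < t → Real.exp (-(E * t)) ≤
      ∫ X, fkWitness (N := n + 1) v L T (fun _ => (1 : ℝ≥0∞)) X *
        fkReal v L t (fkWitness (N := n + 1) v L T (fun _ => (1 : ℝ≥0∞))) X :=
    fun t ht => HB hvm L hT0 (hZne T hT0.le) ht
  set Ψ : Config (n + 1) → ℝ := fkWitness (N := n + 1) v L T (fun _ => (1 : ℝ≥0∞)) with hΨdef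
  have hΨm : Measurable Ψ := measurable_fkWitness hvm L T measurable_const
  have hΨnn : ∀ X, 0 ≤ Ψ X := fkWitness_nonneg v L T _
  have hΨ0 : ∀ X, X ∉ boxN (n + 1) L → Ψ X = 0 := fun X hX => fkWitness_of_notMem v hT0.le _ hX
  set MΨ : ℝ := (Real.sqrt ZTr)⁻¹ with hMΨdef
  have hΨapply : ∀ X, Ψ X = (fkSemigroup v L T (fun _ => (1 : ℝ≥0∞)) X).toReal / Real.sqrt ZTr :=
    fun X => rfl
  have hΨbd : ∀ X, |Ψ X| ≤ MΨ := fun X => by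
    rw [abs_of_nonneg (hΨnn X), hΨapply, hMΨdef, div_eq_mul_inv]
    refine mul_le_of_le_one_left (inv_nonneg.2 (Real.sqrt_nonneg _)) ?_
    exact ENNReal.toReal_le_of_le_ofReal zero_le_one (by
      rw [ENNReal.ofReal_one]; exact fkPartition_le_one v L T X)
  have hΨnorm : ∫ X, Ψ X ^ 2 = 1 := by
    have h1 := lintegral_fkWitness_sq hvm L T (measurable_const : Measurable fun _ : Config (n + 1) =>
      (1 : ℝ≥0∞)) (hZne T hT0.le) (hZtop T hT0.le)
    rw [integral_eq_lintegral_of_nonneg_ae (Eventually.of_forall fun X => sq_nonneg _)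
      ((hΨm.pow_const 2).aestronglyMeasurable)]
    have h2 : ∫⁻ X, ENNReal.ofReal (Ψ X ^ 2) = 1 := by
      rw [← h1]; refine lintegral_congr fun X => ?_
      rw [ENNReal.ofReal_pow (hΨnn X)]
    rw [h2, ENNReal.toReal_one]
  have hΨsymm : ∀ (σ : Equiv.Perm (Fin (n + 1))) (X : Config (n + 1)), Ψ (X ∘ σ) = Ψ X :=
    fun σ X => fkWitness_comp_perm σ hvm L T measurable_const (fun _ => rfl) X
  obtain ⟨hI, hev⟩ := HE1a hvm hL hΨm hΨbd hΨnn hΨ0 hΨnorm heig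
  set I : ℝ≥0∞ := ∫⁻ X, ENNReal.ofReal (Ψ X ^ 2) * interaction v X with hIdef
  have hItop : I ≠ ⊤ := ne_top_of_le_ne_top ENNReal.ofReal_ne_top hI
  have hIE : I.toReal ≤ E := ENNReal.toReal_le_of_le_ofReal hE0 hI
  set K : ℝ := E - I.toReal with hKdef
  have hK : 0 ≤ K := by rw [hKdef]; linarith
  set θ : ℝ := (δr / 2) / (E₀r + δr / 2) with hθdef
  have hθ0 : 0 < θ := by rw [hθdef]; positivity
  set τ : ℝ := min (θ / 4) (1 / (8 * (C + 1))) with hτdef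
  have hτ0 : 0 < τ := lt_min (by positivity) (by positivity)
  have hτθ : τ ≤ θ / 4 := min_le_left _ _
  have hτC : τ ≤ 1 / (8 * (C + 1)) := min_le_right _ _
  have hτ4 : τ ≤ 1 / 4 := by
    refine hτC.trans ?_
    rw [div_le_div_iff₀ (by positivity) (by norm_num)]; nlinarith
  set f : ℝ → Config (n + 1) → ℝ := fun η X => max (Ψ X - η) 0 with hfdef
  have hfm : ∀ η, Measurable (f η) := fun η => (hΨm.sub measurable_const).max measurable_const
  have hfnn : ∀ η X, 0 ≤ f η X := fun η X => le_max_right _ _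
  have hfle : ∀ η, 0 < η → ∀ X, f η X ≤ Ψ X := fun η hη X =>
    max_le (by linarith [hΨnn X]) (hΨnn X)
  have hfbd : ∀ η, 0 < η → ∀ X, |f η X| ≤ MΨ := fun η hη X => by
    rw [abs_of_nonneg (hfnn η X)]
    exact (hfle η hη X).trans ((le_abs_self _).trans (hΨbd X))
  have hf0 : ∀ η, 0 < η → ∀ X, X ∉ boxN (n + 1) L → f η X = 0 := fun η hη X hX => by
    show max (Ψ X - η) 0 = 0
    rw [hΨ0 X hX, max_eq_right (by linarith)]
  have hfsymm : ∀ η (σ : Equiv.Perm (Fin (n + 1))) (X : Config (n + 1)), f η (X ∘ σ) = f η X :=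
    fun η σ X => by show max (Ψ (X ∘ σ) - η) 0 = max (Ψ X - η) 0; rw [hΨsymm σ X]
  have hfne : ∀ η X, f η X ≠ 0 → η < Ψ X := fun η X hX => by
    by_contra hle
    exact hX (max_eq_right (by linarith [not_lt.1 hle]))
  have hfsq_le : ∀ η, 0 < η → ∀ X, ENNReal.ofReal (f η X ^ 2) ≤ ENNReal.ofReal (Ψ X ^ 2) :=
    fun η hη X => ENNReal.ofReal_le_ofReal (pow_le_pow_left₀ (hfnn η X) (hfle η hη X) 2)
  have hratΨ := hrat T hT1
  have hCtop : ENNReal.ofReal C ≠ ⊤ := ENNReal.ofReal_ne_top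
  set e5 : ℝ≥0∞ := ENNReal.ofReal (1 / (16 * (C + 1))) with he5def
  have he5 : 0 < e5 := ENNReal.ofReal_pos.2 (by positivity)
  have h1 : ∀ᶠ η in 𝓝[>] (0 : ℝ), 1 - τ < ∫ X, f η X ^ 2 := by
    have ht := glue_tendsto_integral_posPart_sq (L := L) hΨm hΨbd hΨnn hΨ0
    rw [hΨnorm] at ht
    exact (tendsto_order.1 ht).1 _ (by linarith)
  have h2 : ∀ᶠ η in 𝓝[>] (0 : ℝ), ∫⁻ Y : Config n, ENNReal.ofReal (L ^ 3) *
      (∫⁻ x, (‖f η (Matrix.vecCons x Y)‖₊ : ℝ≥0∞) ^ 2) ^ 2 /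
        (∫⁻ x, (‖f η (Matrix.vecCons x Y)‖₊ : ℝ≥0∞)) ^ 2 < ENNReal.ofReal C + e5 := by
    have ht := glue_tendsto_ratio_posPart (L := L) hΨm hΨbd hΨnn hΨ0
    exact (tendsto_order.1 ht).2 _ (lt_of_le_of_lt hratΨ (ENNReal.lt_add_right hCtop he5.ne'))
  obtain ⟨η, ⟨h1η, h2η⟩, hη⟩ := ((h1.and h2).and self_mem_nhdsWithin).exists
  have hη' : (0 : ℝ) < η := hη
  set ηw : ℝ := η * Real.sqrt ZTr / 2 with hηwdef
  have hηw : 0 < ηw := by rw [hηwdef]; exact div_pos (mul_pos hη' (Real.sqrt_pos.2 hZTr)) two_pos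
  obtain ⟨κw, hκw, Hw⟩ := glue_wall_vanish (N := n + 1) v L hT0 hηw
  obtain ⟨κh, hκh, Hh⟩ := HE2 (N := n + 1) L hT0 hηw
  have hbig : ∀ X, f η X ≠ 0 → ENNReal.ofReal ηw < fkSemigroup v L T (fun _ => (1 : ℝ≥0∞)) X := by
    intro X hX
    have hlt := hfne η X hX
    rw [hΨapply, lt_div_iff₀ (Real.sqrt_pos.2 hZTr)] at hlt
    have hlt' : ηw < (fkSemigroup v L T (fun _ => (1 : ℝ≥0∞)) X).toReal := by
      rw [hηwdef]; linarith [mul_pos hη' (Real.sqrt_pos.2 hZTr)]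
    exact (ENNReal.ofReal_lt_iff_lt_toReal hηw.le
      ((fkPartition_le_one v L T X).trans_lt ENNReal.one_lt_top).ne).2 hlt'
  have hwall : ∀ X, f η X ≠ 0 → ∀ i k, κw ≤ X i k ∧ X i k ≤ L - κw := by
    intro X hX i k
    by_contra hcon
    have h' : ∃ i k, X i k < κw ∨ L - κw < X i k := by
      refine ⟨i, k, ?_⟩
      rcases not_and_or.1 hcon with h | h
      · exact Or.inl (not_le.1 h)
      · exact Or.inr (not_le.1 h)
    exact absurd (Hw X h') (not_le.2 (hbig X hX))
  have hhard : ∀ X, f η X ≠ 0 → ∀ i j : Fin (n + 1), i ≠ j → ∀ z ∈ hardVec v,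
      κh ≤ dist (X i - X j) z := by
    intro X hX i j hij z hz
    by_contra hcon
    exact absurd (Hh X ⟨i, j, hij, z, hz, not_le.1 hcon⟩) (not_le.2 (hbig X hX))
  set r₀ : ℝ := min κw κh / 4 with hr₀def
  have hr₀ : 0 < r₀ := by rw [hr₀def]; exact div_pos (lt_min hκw hκh) four_pos
  have hr₀w : r₀ ≤ κw / 4 := by rw [hr₀def]; gcongr; exact min_le_left _ _
  have hr₀h : r₀ ≤ κh / 4 := by rw [hr₀def]; gcongr; exact min_le_right _ _
  set S : Set (Config (n + 1)) := {X | (∀ i k, κw / 2 ≤ X i k ∧ X i k ≤ L - κw / 2) ∧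
    ∀ i j : Fin (n + 1), i ≠ j → ∀ z ∈ hardVec v, κh / 2 ≤ dist (X i - X j) z} with hSdef
  have hcoord : ∀ (i : Fin (n + 1)) (k : Fin 3), Continuous fun X : Config (n + 1) => X i k :=
    fun i k => (EuclideanSpace.proj k).continuous.comp (continuous_apply i)
  have hSclosed : IsClosed S := by
    have h1 : IsClosed {X : Config (n + 1) | ∀ i k, κw / 2 ≤ X i k ∧ X i k ≤ L - κw / 2} := by
      simp only [Set.setOf_forall]
      exact isClosed_iInter fun i => isClosed_iInter fun k =>
        (isClosed_le continuous_const (hcoord i k)).inter (isClosed_le (hcoord i k) continuous_const)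
    have h2 : IsClosed {X : Config (n + 1) | ∀ i j : Fin (n + 1), i ≠ j → ∀ z ∈ hardVec v,
        κh / 2 ≤ dist (X i - X j) z} := by
      simp only [Set.setOf_forall]
      refine isClosed_iInter fun i => isClosed_iInter fun j => isClosed_iInter fun _ =>
        isClosed_iInter fun z => isClosed_iInter fun _ => ?_
      exact isClosed_le continuous_const
        ((((continuous_apply i).sub (continuous_apply j))).dist continuous_const)
    exact h1.inter h2
  have hSm : MeasurableSet S := hSclosed.measurableSet
  have hSbox : S ⊆ boxN (n + 1) L := by
    intro X hX i k
    have h := hX.1 i k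
    constructor <;> linarith [h.1, h.2]
  have hcoord_le : ∀ (Y X : Config (n + 1)) (i : Fin (n + 1)) (k : Fin 3),
      |Y i k - X i k| ≤ dist Y X := by
    intro Y X i k
    calc |Y i k - X i k| = dist (Y i k) (X i k) := (Real.dist_eq _ _).symm
      _ ≤ dist (Y i) (X i) := by
          rw [EuclideanSpace.dist_eq]
          refine Real.le_sqrt_of_sq_le ?_
          exact Finset.single_le_sum (f := fun l => dist (Y i l) (X i l) ^ 2)
            (fun _ _ => sq_nonneg _) (Finset.mem_univ k)
      _ ≤ dist Y X := dist_le_pi_dist Y X i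
  have hmargin : ∀ X, f η X ≠ 0 → Metric.closedBall X r₀ ⊆ S := by
    intro X hX Y hY
    rw [Metric.mem_closedBall] at hY
    refine ⟨fun i k => ?_, fun i j hij z hz => ?_⟩
    · have h := hwall X hX i k
      have hc := hcoord_le Y X i k
      rw [abs_le] at hc
      constructor <;> linarith [hc.1, hc.2]
    · have h := hhard X hX i j hij z hz
      have hYX : dist X Y ≤ r₀ := by rwa [dist_comm] at hY
      have hd : dist (X i - X j) z ≤ dist (X i - X j) (Y i - Y j) + dist (Y i - Y j) z :=
        dist_triangle _ _ _
      have hd2 : dist (X i - X j) (Y i - Y j) ≤ dist (X i) (Y i) + dist (X j) (Y j) :=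
        dist_sub_sub_le _ _ _ _
      have hi : dist (X i) (Y i) ≤ dist X Y := dist_le_pi_dist X Y i
      have hj : dist (X j) (Y j) ≤ dist X Y := dist_le_pi_dist X Y j
      linarith
  have hSV : ∫⁻ X in S, interaction v X ≠ ⊤ :=
    glue_setLIntegral_interaction_ne_top hv (half_pos hκh) hSm hSbox (fun X hX => hX.2)
  have hev_f : ∀ ε : ℝ, 0 < ε → ∀ᶠ t : ℝ≥0 in 𝓝[>] 0,
      (ENNReal.ofReal (2 * t))⁻¹ * sqIncr t (f η) ≤ ENNReal.ofReal (K + ε) := fun ε hε =>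
    (hev ε hε).mono fun t ht =>
      (mul_le_mul_right (glue_sqIncr_posPart_sub_le Ψ η t) _).trans (by rwa [hKdef])
  have hq : 1 - τ ≤ ∫ X, f η X ^ 2 := h1η.le
  have hpos_f : 0 < ∫ X, f η X ^ 2 := by linarith
  set εb : ℝ := min τ (δr / 8) with hεbdef
  have hεb : 0 < εb := lt_min hτ0 (by positivity)
  obtain ⟨r₁, hr₁, HΦ⟩ := HE1b hvm hL (hfm η) (hfbd η hη') (hfnn η) (hfsymm η) hpos_f hSm hSbox
    hr₀ hmargin hSV hK hev_f hεb
  have hFr := HF (n := n) (L := L) (hfm η) (hfbd η hη') (hfnn η) hr₀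
    (fun X hX => (hmargin X hX).trans hSbox) he5
  have hr1ev : ∀ᶠ r in 𝓝[>] (0 : ℝ), r ∈ Set.Ioo 0 r₁ := Ioo_mem_nhdsGT hr₁
  obtain ⟨r, hrF, hr0, hrr₁⟩ := (hFr.and_eventually hr1ev).exists
  obtain ⟨cc, Φ, hcc, hcq, hΦψ, hΦE⟩ := HΦ r hr0 hrr₁
  have hrFr := hrF hr0
  have hΦX : ∀ X, Φ.ψ X = (((cc * mollify hr0 (f η) X : ℝ)) : ℂ) := fun X => by rw [hΦψ]
  have hg0 : ∀ X, 0 ≤ mollify hr0 (f η) X := fun X => mollify_nonneg hr0 (hfnn η) X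
  have hεbτ : εb ≤ τ := min_le_left _ _
  have hεbδ : εb ≤ δr / 8 := min_le_right _ _
  have hcc2 : 0 ≤ cc ^ 2 := sq_nonneg _
  refine ⟨Φ, ?_, ?_, ?_⟩
  · -- energy
    have hVf : (∫⁻ X, ENNReal.ofReal (f η X ^ 2) * interaction v X) ≤ I :=
      lintegral_mono fun X => mul_le_mul_left (hfsq_le η hη' X) _
    have hsum : ENNReal.ofReal K + I + ENNReal.ofReal εb = ENNReal.ofReal (E + εb) := by
      rw [← ENNReal.ofReal_toReal hItop, ← ENNReal.ofReal_add hK ENNReal.toReal_nonneg,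
        ← ENNReal.ofReal_add (by positivity) hεb.le]
      congr 1; rw [hKdef]; ring
    have harith : cc ^ 2 * (E + εb) ≤ E₀r + δr :=
      glue_arith_energy hE₀r hδr rfl hτ0 hτθ hτ4 hE_le hE0 hεb.le hεbδ hεbτ hq hcc2 hcq
    calc energy v Φ ≤ ENNReal.ofReal (cc ^ 2) * (ENNReal.ofReal K +
          (∫⁻ X, ENNReal.ofReal (f η X ^ 2) * interaction v X) + ENNReal.ofReal εb) := hΦE
      _ ≤ ENNReal.ofReal (cc ^ 2) * (ENNReal.ofReal K + I + ENNReal.ofReal εb) := by gcongr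
      _ = ENNReal.ofReal (cc ^ 2 * (E + εb)) := by
          rw [hsum, ← ENNReal.ofReal_mul hcc2]
      _ ≤ ENNReal.ofReal (E₀r + δr) := ENNReal.ofReal_le_ofReal harith
      _ = E₀ + ENNReal.ofReal δr := by rw [ENNReal.ofReal_add hE₀r hδr.le, ← hE₀eq]
      _ ≤ E₀ + δ := by gcongr
  · -- nonnegativity
    intro X
    rw [hΦX X]
    have h0 : 0 ≤ cc * mollify hr0 (f η) X := mul_nonneg hcc.le (hg0 X)
    rw [Complex.norm_real, Real.norm_of_nonneg h0]
  · -- ratio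
    have hratio : ∫⁻ Y : Config n, ENNReal.ofReal (L ^ 3) *
        (∫⁻ x, (‖Φ.ψ (Matrix.vecCons x Y)‖₊ : ℝ≥0∞) ^ 2) ^ 2 /
          (∫⁻ x, (‖Φ.ψ (Matrix.vecCons x Y)‖₊ : ℝ≥0∞)) ^ 2 =
        ENNReal.ofReal (cc ^ 2) * ∫⁻ Y : Config n, ENNReal.ofReal (L ^ 3) *
          (∫⁻ x, (‖mollify hr0 (f η) (Matrix.vecCons x Y)‖₊ : ℝ≥0∞) ^ 2) ^ 2 /
            (∫⁻ x, (‖mollify hr0 (f η) (Matrix.vecCons x Y)‖₊ : ℝ≥0∞)) ^ 2 := by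
      rw [← lintegral_ratio_const_mul L (mollify hr0 (f η)) hcc.ne']
      simp_rw [hΦX, Complex.nnnorm_real]
    rw [hratio]
    have he55 : e5 + e5 = ENNReal.ofReal (1 / (8 * (C + 1))) := by
      rw [he5def, ← ENNReal.ofReal_add (by positivity) (by positivity)]
      congr 1; field_simp; ring
    have harith : cc ^ 2 * (C + 1 / (8 * (C + 1))) ≤ C + 1 :=
      glue_arith_ratio hC0 hτ0 hτC hεbτ hq hcc2 hcq
    calc ENNReal.ofReal (cc ^ 2) * ∫⁻ Y : Config n, ENNReal.ofReal (L ^ 3) *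
          (∫⁻ x, (‖mollify hr0 (f η) (Matrix.vecCons x Y)‖₊ : ℝ≥0∞) ^ 2) ^ 2 /
            (∫⁻ x, (‖mollify hr0 (f η) (Matrix.vecCons x Y)‖₊ : ℝ≥0∞)) ^ 2
        ≤ ENNReal.ofReal (cc ^ 2) * (ENNReal.ofReal C + e5 + e5) := by
          gcongr
          exact hrFr.trans (by gcongr)
      _ = ENNReal.ofReal (cc ^ 2 * (C + 1 / (8 * (C + 1)))) := by
          rw [add_assoc, he55, ← ENNReal.ofReal_add hC0 (by positivity), ← ENNReal.ofReal_mul hcc2]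
      _ ≤ ENNReal.ofReal (C + 1) := ENNReal.ofReal_le_ofReal harith



end Summit.AtomisticToContinuum.BoseEinsteinCondensation.Theorems.CutLineWitness

end
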